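import Mathlib
import Literature.Computability.AlgebraicComplexity.BirkhoffShadow
import Literature.Computability.AlgebraicComplexity.BirkhoffShadowLowerBound
import Summits.ValiantsHypothesis.ValiantsHypothesis.Theses.DivisionGap
import Summits.ValiantsHypothesis.ValiantsHypothesis.Theorems.DivisionGapShadowBirkhoffStubFacePad
import Summits.ValiantsHypothesis.ValiantsHypothesis.Theorems.DivisionGapShadowBirkhoffStubFaceVertices
import Summits.ValiantsHypothesis.ValiantsHypothesis.Theorems.DivisionGapShadowBirkhoffStubFaceShadow
import Summits.ValiantsHypothesis.ValiantsHypothesis.Theorems.DivisionGapShadowBirkhoffCounterDefs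

/-!
# `DivisionGap.ShadowBirkhoff` (stmt-ValiantsHypothesis-5069), line `Sketch-ideator4` —
# stub `stub_bridge`

Certification step of the line: the lower vertices of the planar value set of a weighted pattern
are shadow vertices of the Birkhoff polytope `DS_n`, so that a family of patterns of size `≤ n`
with more than `2^((log₂ n + c)^c)` lower vertices proves the crux
`Summit.ValiantsHypothesis.ValiantsHypothesis.Theses.DivisionGap.ShadowBirkhoff` by name.

Data (objects of `Theorems/DivisionGapShadowBirkhoffCounterDefs.lean`): a pattern `G ⊆ [N]²` with
weight tables `wb, wa`; along a permutation `ρ` write `b(ρ) = Σ_u wb(u, ρ u)`,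
`a(ρ) = Σ_u wa(u, ρ u)`; `valueSet G wb wa = {(b ρ, a ρ) : ρ supported in G}` and
`lowerVertices S = {p ∈ S | ∃ μ, ∀ q ∈ S, q ≠ p → p.2 − μ p.1 < q.2 − μ q.1}`.

Proof.  Pad the pattern to size `n` (`stub_facePad`: the value set is unchanged).  For each lower
vertex `p` pick a slope `μ_p`, choose a penalty `P ≥ 0` exceeding the finitely many numbers
(`faceVertices_exists_nonneg_forall_lt` of the sibling stub file `StubFaceVertices`)
`μ_{p₀}·b ρ − a ρ − (μ_{p₀}·b ρ₀ − a ρ₀)` (`p₀ = (b ρ₀, a ρ₀)`), and put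
`L = BirkhoffShadowLower.Lmap (fun u v => (wb u v, wa u v + P·[(u, v) ∉ G]))`; on the
permutation matrix of `ρ` it evaluates to `![b ρ, a ρ + Σ_u P·[(u, ρ u) ∉ G]]` (`Lmap_perm_eq`).
For a lower vertex `p = (b ρ₀, a ρ₀)` (`ρ₀` supported) the point `![p.1, p.2] = L(matrix ρ₀)` is
the unique maximiser over the projected permutation matrices of the continuous linear functional
`y ↦ μ_p·y 0 − y 1` (the lower-vertex inequality for supported `ρ` with `(b ρ, a ρ) ≠ p`; `y ≠ z`
for supported `ρ` with `(b ρ, a ρ) = p`; the penalty for unsupported `ρ`), hence an extreme point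
of the shadow (`BirkhoffShadowLower.mem_extremePoints_convexHull_of_forall_lt`).  Distinct `p`
give distinct points, the extreme points form a finite set (`extremePoints_convexHull_subset`),
and `Set.ncard_le_ncard_of_injOn` concludes; the crux's vertex count is
`birkhoffShadowVertexCount L` by unfolding.
-/

set_option linter.dupNamespace false

noncomputable section

open scoped BigOperators

namespace Summit.ValiantsHypothesis.ValiantsHypothesis.Theorems.DivisionGapShadowBirkhoff

open Literature.Computability.AlgebraicComplexity

/-- **Lower vertices of a pattern's value set are shadow vertices of `DS_n`.**  For a weighted
pattern `G ⊆ [n]²` there is a linear `L : ℝ^{n×n} → ℝ²` (slope `wb`, intercept `wa` plus a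
penalty off the pattern) such that the number of lower vertices of `valueSet G wb wa` is at most
the number of vertices of the shadow `L(DS_n)`: each lower vertex `p` (strict minimiser of
`q ↦ q.2 − μ_p q.1`) is the strict unique maximiser of `y ↦ μ_p·y 0 − y 1` over the projected
permutation matrices, hence an extreme point, and distinct `p` give distinct points. [folklore] -/
theorem bridge_ncard_lowerVertices_le {n : ℕ} (G : Finset (Fin n × Fin n))
    (wb wa : Fin n → Fin n → ℝ) :
    ∃ L : (Fin n × Fin n → ℝ) →ₗ[ℝ] (Fin 2 → ℝ),
      (lowerVertices (valueSet G wb wa)).ncard ≤ birkhoffShadowVertexCount L := by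
  classical
  -- a slope witnessing each lower vertex
  obtain ⟨μ, hμ⟩ : ∃ μ : ℝ × ℝ → ℝ, ∀ p ∈ lowerVertices (valueSet G wb wa),
      ∀ q ∈ valueSet G wb wa, q ≠ p → p.2 - μ p * p.1 < q.2 - μ p * q.1 := by
    refine ⟨fun p => if hp : p ∈ lowerVertices (valueSet G wb wa) then Classical.choose hp.2
      else 0, fun p hp => ?_⟩
    dsimp only
    rw [dif_pos hp]
    exact Classical.choose_spec hp.2
  -- a penalty exceeding the finitely many defects
  obtain ⟨P, hP0, hP⟩ : ∃ P : ℝ, 0 ≤ P ∧ ∀ ρ ρ₀ : Equiv.Perm (Fin n),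
      μ (∑ u, wb u (ρ₀ u), ∑ u, wa u (ρ₀ u)) * ∑ u, wb u (ρ u) - ∑ u, wa u (ρ u)
        - (μ (∑ u, wb u (ρ₀ u), ∑ u, wa u (ρ₀ u)) * ∑ u, wb u (ρ₀ u) - ∑ u, wa u (ρ₀ u))
          < P := by
    obtain ⟨P, hP0, hP⟩ := faceVertices_exists_nonneg_forall_lt
      fun pr : Equiv.Perm (Fin n) × Equiv.Perm (Fin n) =>
        μ (∑ u, wb u (pr.2 u), ∑ u, wa u (pr.2 u)) * ∑ u, wb u (pr.1 u) - ∑ u, wa u (pr.1 u)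
          - (μ (∑ u, wb u (pr.2 u), ∑ u, wa u (pr.2 u)) * ∑ u, wb u (pr.2 u)
              - ∑ u, wa u (pr.2 u))
    exact ⟨P, hP0, fun ρ ρ₀ => hP (ρ, ρ₀)⟩
  -- the weights of the linear map: slope `wb`, intercept `wa` plus the penalty off the pattern
  obtain ⟨v, hv⟩ : ∃ v : Fin n → Fin n → ℝ × ℝ,
      ∀ u w, v u w = (wb u w, wa u w + if (u, w) ∈ G then 0 else P) := ⟨_, fun _ _ => rfl⟩
  refine ⟨BirkhoffShadowLower.Lmap v, ?_⟩
  -- the two coordinates of `Lmap v` on the permutation matrix of `ρ`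
  have hfst : ∀ ρ : Equiv.Perm (Fin n), (∑ u, v u (ρ u)).1 = ∑ u, wb u (ρ u) := by
    intro ρ
    rw [Prod.fst_sum]
    simp only [hv]
  have hsnd : ∀ ρ : Equiv.Perm (Fin n), (∑ u, v u (ρ u)).2 =
      ∑ u, wa u (ρ u) + ∑ u, (if (u, ρ u) ∈ G then (0 : ℝ) else P) := by
    intro ρ
    rw [Prod.snd_sum, ← Finset.sum_add_distrib]
    simp only [hv]
  -- no penalty on supported permutations, penalty at least `P` on the others
  have hpen0 : ∀ ρ : Equiv.Perm (Fin n), (∀ u, (u, ρ u) ∈ G) →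
      ∑ u, (if (u, ρ u) ∈ G then (0 : ℝ) else P) = 0 := fun ρ hρ =>
    Finset.sum_eq_zero fun u _ => if_pos (hρ u)
  have hpenP : ∀ ρ : Equiv.Perm (Fin n), (¬ ∀ u, (u, ρ u) ∈ G) →
      P ≤ ∑ u, (if (u, ρ u) ∈ G then (0 : ℝ) else P) := by
    intro ρ hρ
    push Not at hρ
    obtain ⟨u₀, hu₀⟩ := hρ
    calc P = (if (u₀, ρ u₀) ∈ G then (0 : ℝ) else P) := by rw [if_neg hu₀]
      _ ≤ ∑ u, (if (u, ρ u) ∈ G then (0 : ℝ) else P) :=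
        Finset.single_le_sum (f := fun u => if (u, ρ u) ∈ G then (0 : ℝ) else P)
          (fun u _ => by positivity) (Finset.mem_univ u₀)
  -- the projected permutation matrices form a finite set
  set T : Set (Fin 2 → ℝ) := BirkhoffShadowLower.Lmap v '' permMatrixPoints n with hT
  have hfin : T.Finite := (faceShadow_permMatrixPoints_finite n).image _
  -- the planar point `p` as a vector of `Fin 2 → ℝ`
  obtain ⟨z, hz⟩ : ∃ z : ℝ × ℝ → (Fin 2 → ℝ), ∀ p, z p = ![p.1, p.2] := ⟨_, fun _ => rfl⟩
  have hz0 : ∀ p, z p 0 = p.1 := fun p => by simp [hz]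
  have hz1 : ∀ p, z p 1 = p.2 := fun p => by simp [hz]
  -- the value of `Lmap v` at a supported `ρ` is the point `(b ρ, a ρ)`
  have hval : ∀ ρ : Equiv.Perm (Fin n), (∀ u, (u, ρ u) ∈ G) →
      BirkhoffShadowLower.Lmap v
        (fun ij : Fin n × Fin n => if ρ ij.2 = ij.1 then (1 : ℝ) else 0) =
          z (∑ u, wb u (ρ u), ∑ u, wa u (ρ u)) := by
    intro ρ hρ
    rw [BirkhoffShadowLower.Lmap_perm_eq, hfst, hsnd, hpen0 ρ hρ, add_zero, hz]
  have hmem : ∀ p ∈ lowerVertices (valueSet G wb wa),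
      z p ∈ (convexHull ℝ T).extremePoints ℝ := by
    intro p hp
    have hμp := hμ p hp
    obtain ⟨⟨ρ₀, hρ₀, hp₀⟩, -⟩ := hp
    have hp1 : ∑ u, wb u (ρ₀ u) = p.1 := by rw [← hp₀]
    have hp2 : ∑ u, wa u (ρ₀ u) = p.2 := by rw [← hp₀]
    -- the supporting functional `y ↦ μ p · y 0 - y 1`
    let l : (Fin 2 → ℝ) →L[ℝ] ℝ :=
      (μ p) • ContinuousLinearMap.proj (R := ℝ) (φ := fun _ : Fin 2 => ℝ) 0 -
        ContinuousLinearMap.proj (R := ℝ) (φ := fun _ : Fin 2 => ℝ) 1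
    have hl : ∀ y : Fin 2 → ℝ, l y = μ p * y 0 - y 1 := by
      intro y
      simp [l]
    apply BirkhoffShadowLower.mem_extremePoints_convexHull_of_forall_lt l
    · exact ⟨_, ⟨ρ₀, rfl⟩, by rw [hval ρ₀ hρ₀, hp₀]⟩
    · rintro y ⟨x, ⟨ρ, rfl⟩, rfl⟩ hne
      rw [hl, hl, hz0, hz1, BirkhoffShadowLower.Lmap_perm_eq, hfst, hsnd]
      simp only [Matrix.cons_val_zero, Matrix.cons_val_one]
      by_cases hsupp : ∀ u, (u, ρ u) ∈ G
      · -- supported: a point of the value set, strictly above the supporting line of `p`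
        rw [hpen0 ρ hsupp, add_zero]
        have hqS : (∑ u, wb u (ρ u), ∑ u, wa u (ρ u)) ∈ valueSet G wb wa := ⟨ρ, hsupp, rfl⟩
        have hqp : (∑ u, wb u (ρ u), ∑ u, wa u (ρ u)) ≠ p := fun h =>
          hne (by rw [hval ρ hsupp, h])
        have hlt := hμp _ hqS hqp
        dsimp only at hlt
        linarith
      · -- unsupported: the penalty
        have hpe := hpenP ρ hsupp
        have hPρ := hP ρ ρ₀
        rw [hp₀, hp1, hp2] at hPρ
        linarith
  have hinj : Set.InjOn z (lowerVertices (valueSet G wb wa)) := by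
    intro s _ s' _ h
    have h0 := congrFun h 0
    have h1 := congrFun h 1
    rw [hz0, hz0] at h0
    rw [hz1, hz1] at h1
    exact Prod.ext h0 h1
  have hfinE : ((convexHull ℝ T).extremePoints ℝ).Finite :=
    hfin.subset extremePoints_convexHull_subset
  exact Set.ncard_le_ncard_of_injOn z hmem hinj hfinE

/-- **`stub_bridge`** (registered stub of the line `Sketch-ideator4` for `DivisionGap.ShadowBirkhoff`,
item `stmt-ValiantsHypothesis-5069`): lower vertices are shadow vertices.  If for every `c` and
all large `n` some weighted pattern of size `N ≤ n` has more than `2^((log₂ n + c)^c)` lower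
vertices, then the shadow complexity of `DS_n` is super-quasi-polynomial (the crux, by name):
pad the pattern to size `n` (`stub_facePad`, same value set) and apply
`bridge_ncard_lowerVertices_le`; the crux's vertex count is `birkhoffShadowVertexCount L` by
unfolding. -/
theorem stub_bridge
    (h : ∀ c : ℕ, ∃ n₀ : ℕ, ∀ n ≥ n₀, ∃ N ≤ n,
      ∃ (G : Finset (Fin N × Fin N)) (wb wa : Fin N → Fin N → ℝ),
        2 ^ ((Nat.log 2 n + c) ^ c) < (lowerVertices (valueSet G wb wa)).ncard) :
    Summit.ValiantsHypothesis.ValiantsHypothesis.Theses.DivisionGap.ShadowBirkhoff := by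
  show ∀ c : ℕ, ∃ n₀ : ℕ, ∀ n ≥ n₀, ∃ L : (Fin n × Fin n → ℝ) →ₗ[ℝ] (Fin 2 → ℝ),
      2 ^ ((Nat.log 2 n + c) ^ c) < birkhoffShadowVertexCount L
  intro c
  obtain ⟨n₀, hn₀⟩ := h c
  refine ⟨n₀, fun n hn => ?_⟩
  obtain ⟨N, hNn, G, wb, wa, hcount⟩ := hn₀ n hn
  -- pad the pattern to size `n`: the value set is unchanged
  obtain ⟨G', wb', wa', hpad⟩ := stub_facePad hNn G wb wa
  have hpad' : valueSet G' wb' wa' = valueSet G wb wa := hpad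
  obtain ⟨L, hL⟩ := bridge_ncard_lowerVertices_le G' wb' wa'
  rw [hpad'] at hL
  exact ⟨L, lt_of_lt_of_le hcount hL⟩

end Summit.ValiantsHypothesis.ValiantsHypothesis.Theorems.DivisionGapShadowBirkhoff

end
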